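import Summits.Ventures.WeilGRH.FlatWindowSpectralGRH
import Summits.Ventures.WeilGRH.TwistedModulationCost
import HarnessLib

/-!
# GRH arm (rh-explicit, venture WeilGRH): ONE RUNG BOUNDS THE SPECTRAL MULTIPLICITY AT EVERY HEIGHT

Cell `rh-explicit`, WEIL TRACK (structure seat weil-3, gen9) for the GRH ARM.  Sequel of
`FlatWindowSpectral.lean` (the flat-window identity) and `TwistedModulatedFlatTest.lean` /
`TwistedModulationCost.lean` (gen7: modulation rotates the twist; its archimedean cost is the digamma
weight).  The MODULATED flat window `e^{−iτx}χ_0` has transform `χ̂_0(½+i(t−τ))` — the Fejér kernel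
CENTRED AT `τ` — so the identity of `TwistedWindowMeasure.lean` weighs the spectral atom at `τ` by `2a`:

* `two_mul_mul_atom_le` (exact form) and **`two_mul_mul_atom_le_budget`**: for `χ` mod `q ≠ 1`, `a > 0`,
  ANY positive `μ` representing `Q_χ` on the tests of `[-a, a]` with `(1+t²)⁻¹ ∈ L¹(μ)`, and every `τ ∈ ℝ`,

  `2a·μ{τ} ≤ log q − K_κ + [Re ψ(¼ + iτ/2) − Re ψ(¼)] + 5/a + 2Σ_{log n<2a} Λ(n)n^{-1/2}(1 − log n/(2a))`

  (RH/GRH-free): conductor + the archimedean weight of the explicit formula at height `τ` + the prime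
  budget of the window, divided by the window;
* `charZeroHeightMeasure_singleton_of_grh`: under `GRH(χ)`, `ν_χ{τ} = ord_{s=½+iτ} L(s, χ)`;
* **`two_mul_mul_zeroOrder_le_of_grh`**: `GRH(χ)`, `χ` primitive mod `q ≠ 1` ⟹ for every `a > 0`, `τ`:
  `2a·ord_{s=½+iτ} L(s,χ) ≤ log q − K_κ + [Re ψ(¼+iτ/2) − Re ψ(¼)] + 5/a + 2Σ_{log n<2a}Λ(n)n^{-1/2}(1 − log n/(2a))`.
  With `2Σ_{n<e^{2a}}Λ(n)n^{-1/2}(1 − log n/(2a)) ~ 4e^a/a` and `a = log L − log log L`,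
  `L = log(q(|τ|+3))`, this is `ord ≤ (½ + o(1)) L/log L` — the Goldston–Gonek 2007 shape and constant
  for the multiplicity of zeros under (G)RH, here from Weil POSITIVITY at one window (on paper; the theorem
  is the inequality at every `a`).

No definitions, no named facts; RH/GRH-free except the `_of_grh` corollaries.

## References

* A. Weil, *Sur les "formules explicites" de la théorie des nombres premiers* (1952), (11) pp. 261–262.
  [Weil1952FormulesExplicites]
* D. A. Goldston, S. M. Gonek, *A note on S(t) and the zeros of the Riemann zeta-function*, Bull. London
  Math. Soc. 39 (2007) 482–486 (`m(γ) ≤ (½ + o(1)) log γ/log log γ` on RH). [GoldstonGonek2007]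
-/

set_option autoImplicit false

noncomputable section

open Complex Filter Set MeasureTheory
open scoped Real Topology ComplexConjugate ArithmeticFunction.vonMangoldt

namespace Summit.Ventures.WeilGRH

open Literature.NumberTheory.LFunctions
open Literature.NumberTheory.LFunctions.Yoshida1992 (chi chiCore)
open Literature.NumberTheory.LFunctions.ExplicitPsiChar
open Literature.NumberTheory.LFunctions.WeilBochner (charZeroHeightMeasure)
open Literature.Analysis.SpecialFunctions (reDigammaQuarter)
open Summit.RiemannHypothesis.RiemannHypothesis.Theorems.WeilFormatC

variable {q : ℕ} {a : ℝ}

/-! ## The modulated flat window: its transform is the shifted `sinc` -/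

/-- **Modulation shifts the transform**: `(e^{iτx}χ_0)^(½+it) = χ̂_0(½+i(t+τ))`. -/
theorem weilMellin_modulated_chi_zero (a τ t : ℝ) :
    weilMellin (fun x ↦ cexp (I * (τ * x : ℝ)) * chi a 0 x) (1 / 2 + t * I) =
      weilMellin (chi a 0) (1 / 2 + ((t + τ : ℝ) : ℂ) * I) := by
  unfold weilMellin
  refine integral_congr_ae (Eventually.of_forall fun x ↦ ?_)
  show cexp (I * (τ * x : ℝ)) * chi a 0 x * cexp ((1 / 2 + (t : ℂ) * I - 1 / 2) * (x : ℂ)) =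
    chi a 0 x * cexp ((1 / 2 + ((t + τ : ℝ) : ℂ) * I - 1 / 2) * (x : ℂ))
  rw [mul_comm (cexp _) (chi a 0 x), mul_assoc, ← Complex.exp_add]
  congr 2
  push_cast
  ring

/-- At the height opposite to the modulation the transform is the full window: `‖(e^{−iτx}χ_0)^(½+iτ)‖² = 2a`. -/
theorem norm_sq_weilMellin_modulated_chi_zero_self (ha : 0 < a) (τ : ℝ) :
    ‖weilMellin (fun x ↦ cexp (I * ((-τ) * x : ℝ)) * chi a 0 x) (1 / 2 + τ * I)‖ ^ 2 = 2 * a := by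
  rw [weilMellin_modulated_chi_zero, show τ + -τ = (0 : ℝ) by ring, norm_sq_weilMellin_chi_zero_zero ha]

/-- A measure integrating `(1 + t²)⁻¹` gives finite mass to every point. -/
theorem measure_singleton_lt_top_of_integrable {μ : Measure ℝ}
    (hI : Integrable (fun t : ℝ ↦ (1 + t ^ 2)⁻¹) μ) (τ : ℝ) : μ {τ} < ⊤ := by
  have hε : (0 : ℝ) < (1 + τ ^ 2)⁻¹ := by positivity
  refine lt_of_le_of_lt (measure_mono fun t ht ↦ ?_) (hI.measure_norm_ge_lt_top hε)
  rw [mem_singleton_iff] at ht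
  subst ht
  show (1 + t ^ 2)⁻¹ ≤ ‖(1 + t ^ 2)⁻¹‖
  rw [Real.norm_of_nonneg hε.le]

/-! ## The atom bound at every height (measure level, RH/GRH-free) -/

/-- **ONE RUNG BOUNDS THE SPECTRAL MASS AT EVERY HEIGHT (exact form).**  Let `q ≠ 1`, `a > 0`, `μ`
represent `Q_χ` on the tests of `[-a, a]`, `(1+t²)⁻¹ ∈ L¹(μ)`.  Then for every `τ ∈ ℝ`

  `2a·μ{τ} ≤ log q − 2Σ_{log n<2a} Λ(n)n^{-1/2}(1 − log n/(2a)) Re(χ(n)n^{−iτ}) − K_κ`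
            `+ ∫₀^∞ ρ_κ(t)(2(1 − cos τt) + cos(τt) min(t,2a)/a) dt`

(the modulated flat window `e^{−iτx}χ_0`: its twisted window form is `∫ 2sin²(a(t−τ))/(a(t−τ)²) dμ(t)`
by `twistedWindowForm_eq_integral`, in closed form by `twistedWindowForm_modulated_chi_zero`, and the
Fejér kernel centred at `τ` weighs the atom at `τ` by `2a`). -/
theorem two_mul_mul_atom_le (hq : q ≠ 1) (χ : DirichletCharacter ℂ q) (ha : 0 < a) {μ : Measure ℝ}
    (hμ : ∀ g : ℝ → ℂ, IsWeilTest g → tsupport g ⊆ Icc (-a) a →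
      Integrable (fun t : ℝ ↦ ‖weilMellin g (1 / 2 + t * I)‖ ^ 2) μ ∧
        weilQuadraticChar χ g = ((∫ t, ‖weilMellin g (1 / 2 + t * I)‖ ^ 2 ∂μ : ℝ) : ℂ))
    (hI : Integrable (fun t : ℝ ↦ (1 + t ^ 2)⁻¹) μ) (τ : ℝ) :
    2 * a * μ.real {τ} ≤
      Real.log q -
        2 * (∑ n ∈ weilPrimeIndex a, (Λ n : ℝ) / Real.sqrt n *
          ((1 - Real.log n / (2 * a)) * (χ (n : ZMod q) * cexp (I * ((-τ) * Real.log n : ℝ))).re)) -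
        (Real.log (4 * π) + Real.eulerMascheroniConstant +
          2 * ∫ t in Ioi (0 : ℝ), weilKillingDensityPar (charParity χ) t) +
        ∫ t in Ioi (0 : ℝ), weilArchDensityPar (charParity χ) t *
          (2 * (1 - Real.cos (τ * t)) + Real.cos (τ * t) * (min t (2 * a) / a)) := by
  obtain ⟨hf, huf⟩ := modulated_chi_zero_smooth_inside a (-τ)
  obtain ⟨hint, heq⟩ := twistedWindowForm_eq_integral hq χ ha hμ hI
    (isWindowFunction_modulated_chi_zero ha (-τ)) hf huf
  rw [twistedWindowForm_modulated_chi_zero χ ha (-τ)] at heq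
  have hcos : ∀ t : ℝ, Real.cos (-τ * t) = Real.cos (τ * t) := fun t ↦ by rw [neg_mul, Real.cos_neg]
  simp only [hcos] at heq
  -- the Fejér integral dominates the atom at `τ`
  set u : ℝ → ℂ := fun x ↦ cexp (I * ((-τ) * x : ℝ)) * chi a 0 x with hu
  have h0 := measure_singleton_lt_top_of_integrable hI τ
  have hind : Integrable (fun t : ℝ ↦ ({τ} : Set ℝ).indicator (fun _ ↦ 2 * a) t) μ :=
    (integrable_indicator_iff (measurableSet_singleton τ)).2 (integrableOn_const h0.ne)
  have hle : ∀ t : ℝ, ({τ} : Set ℝ).indicator (fun _ ↦ 2 * a) t ≤ ‖weilMellin u (1 / 2 + t * I)‖ ^ 2 := by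
    intro t
    by_cases ht : t ∈ ({τ} : Set ℝ)
    · rw [indicator_of_mem ht, mem_singleton_iff.1 ht, hu, norm_sq_weilMellin_modulated_chi_zero_self ha]
    · rw [indicator_of_notMem ht]; positivity
  have hatom : 2 * a * μ.real {τ} ≤ ∫ t, ‖weilMellin u (1 / 2 + t * I)‖ ^ 2 ∂μ := by
    calc 2 * a * μ.real {τ} = ∫ t, ({τ} : Set ℝ).indicator (fun _ ↦ 2 * a) t ∂μ := by
          rw [integral_indicator_const _ (measurableSet_singleton τ), smul_eq_mul, mul_comm]
      _ ≤ _ := integral_mono hind hint hle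
  linarith

/-- **The archimedean cost of modulation is at most the digamma weight plus `5/a`**:
`∫₀^∞ ρ_κ(t)(2(1 − cos τt) + cos(τt) min(t,2a)/a) dt ≤ [Re ψ(¼+iτ/2) − Re ψ(¼)] + 5/a`
(`ρ_κ ≤ ρ₀`, `∫ρ₀·2(1 − cos τt) = Re ψ(¼+iτ/2) − Re ψ(¼)` (`TwistedModulationCost`), `tρ₀(t) ≤ e^{−t/2}(1+2t)/2`
with integral `5`). -/
theorem integral_modulationCost_le (κ : ℕ) (ha : 0 < a) (τ : ℝ) :
    ∫ t in Ioi (0 : ℝ), weilArchDensityPar κ t *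
        (2 * (1 - Real.cos (τ * t)) + Real.cos (τ * t) * (min t (2 * a) / a)) ≤
      (reDigammaQuarter τ - reDigammaQuarter 0) + 5 / a := by
  have hF := integrableOn_weilArchDensity_modulation τ
  have hG : IntegrableOn (fun t : ℝ ↦ 1 / a * (Real.exp (-(1 / 2 * t)) * (1 + 2 * t) / 2)) (Ioi 0) :=
    integrableOn_flatWindow_archMajorant.const_mul _
  have hrhs : ∫ t in Ioi (0 : ℝ), (weilArchDensity t * (2 * (1 - Real.cos (τ * t))) +
      1 / a * (Real.exp (-(1 / 2 * t)) * (1 + 2 * t) / 2)) = (reDigammaQuarter τ - reDigammaQuarter 0) + 5 / a := by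
    rw [integral_add hF hG, integral_const_mul, integral_weilArchDensity_modulationCost,
      integral_flatWindow_archMajorant]
    ring
  rw [← hrhs]
  refine integral_mono_of_nonneg ?_ (hF.add hG) ?_
  · refine (ae_restrict_iff' measurableSet_Ioi).2 (Eventually.of_forall fun t (ht : 0 < t) ↦ ?_)
    have hρ := (weilArchDensityPar_nonneg_le κ ht).1
    have hc := (two_mul_one_sub_cos_mem (τ * t)).1
    have hcos := Real.neg_one_le_cos (τ * t)
    have hm0 : 0 ≤ min t (2 * a) / a := div_nonneg (le_min ht.le (by linarith)) ha.le
    have hm2 : min t (2 * a) / a ≤ 2 := by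
      rw [div_le_iff₀ ha]; exact min_le_right _ _
    -- `2(1 − c) + c·m ≥ 0` for `c ∈ [−1,1]`, `m ∈ [0,2]`
    have hin : 0 ≤ 2 * (1 - Real.cos (τ * t)) + Real.cos (τ * t) * (min t (2 * a) / a) := by
      nlinarith [Real.cos_le_one (τ * t)]
    exact mul_nonneg hρ hin
  · refine (ae_restrict_iff' measurableSet_Ioi).2 (Eventually.of_forall fun t (ht : 0 < t) ↦ ?_)
    obtain ⟨hρ0, hρle⟩ := weilArchDensityPar_nonneg_le κ ht
    have hc := (two_mul_one_sub_cos_mem (τ * t)).1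
    have hcos1 := Real.cos_le_one (τ * t)
    have hm0 : 0 ≤ min t (2 * a) := le_min ht.le (by linarith)
    have hmt : min t (2 * a) ≤ t := min_le_left _ _
    have htρ : t * weilArchDensityPar κ t ≤ Real.exp (-(1 / 2 * t)) * (1 + 2 * t) / 2 :=
      (mul_le_mul_of_nonneg_left hρle ht.le).trans (mul_weilArchDensity_le ht)
    -- `ρ_κ·2(1−c) ≤ ρ₀·2(1−c)` and `ρ_κ·c·m/a ≤ ρ_κ·m/a ≤ tρ_κ/a ≤ majorant/a`
    have h1 : weilArchDensityPar κ t * (2 * (1 - Real.cos (τ * t))) ≤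
        weilArchDensity t * (2 * (1 - Real.cos (τ * t))) := mul_le_mul_of_nonneg_right hρle hc
    have h2 : weilArchDensityPar κ t * (Real.cos (τ * t) * (min t (2 * a) / a)) ≤
        1 / a * (Real.exp (-(1 / 2 * t)) * (1 + 2 * t) / 2) := by
      calc weilArchDensityPar κ t * (Real.cos (τ * t) * (min t (2 * a) / a))
          ≤ weilArchDensityPar κ t * (1 * (min t (2 * a) / a)) := by
            refine mul_le_mul_of_nonneg_left ?_ hρ0
            exact mul_le_mul_of_nonneg_right hcos1 (div_nonneg hm0 ha.le)
        _ = 1 / a * (min t (2 * a) * weilArchDensityPar κ t) := by ring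
        _ ≤ 1 / a * (t * weilArchDensityPar κ t) := by
            refine mul_le_mul_of_nonneg_left (mul_le_mul_of_nonneg_right hmt hρ0) (by positivity)
        _ ≤ 1 / a * (Real.exp (-(1 / 2 * t)) * (1 + 2 * t) / 2) :=
            mul_le_mul_of_nonneg_left htρ (by positivity)
    calc weilArchDensityPar κ t * (2 * (1 - Real.cos (τ * t)) + Real.cos (τ * t) * (min t (2 * a) / a))
        = weilArchDensityPar κ t * (2 * (1 - Real.cos (τ * t))) +
            weilArchDensityPar κ t * (Real.cos (τ * t) * (min t (2 * a) / a)) := by ring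
      _ ≤ _ := add_le_add h1 h2

/-- The twisted modulated prime sum is at least minus the trivial-key sum: `|Re(χ(n)n^{−iτ})| ≤ 1` and the
flat weights are `≥ 0` below the horizon. -/
theorem neg_flatSum_le_modulated_flatSum (χ : DirichletCharacter ℂ q) (ha : 0 < a) (τ : ℝ) :
    -(∑ n ∈ weilPrimeIndex a, (Λ n : ℝ) / Real.sqrt n * (1 - Real.log n / (2 * a))) ≤
      ∑ n ∈ weilPrimeIndex a, (Λ n : ℝ) / Real.sqrt n *
        ((1 - Real.log n / (2 * a)) * (χ (n : ZMod q) * cexp (I * ((-τ) * Real.log n : ℝ))).re) := by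
  rw [← Finset.sum_neg_distrib]
  refine Finset.sum_le_sum fun n hn ↦ ?_
  have hlog : Real.log n < 2 * a := mem_weilPrimeIndex.1 hn
  have hw : 0 ≤ 1 - Real.log n / (2 * a) := by
    rw [sub_nonneg, div_le_one (by linarith)]; exact hlog.le
  have hΛ : 0 ≤ (Λ n : ℝ) / Real.sqrt n := div_nonneg ArithmeticFunction.vonMangoldt_nonneg (Real.sqrt_nonneg _)
  have hre : -1 ≤ (χ (n : ZMod q) * cexp (I * ((-τ) * Real.log n : ℝ))).re := by
    have h1 : ‖χ (n : ZMod q) * cexp (I * ((-τ) * Real.log n : ℝ))‖ ≤ 1 := by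
      rw [norm_mul, Complex.norm_exp_I_mul_ofReal, mul_one]; exact χ.norm_le_one _
    have h2 := (abs_re_le_norm (χ (n : ZMod q) * cexp (I * ((-τ) * Real.log n : ℝ)))).trans h1
    exact (abs_le.1 h2).1
  have : -((Λ n : ℝ) / Real.sqrt n * (1 - Real.log n / (2 * a))) =
      (Λ n : ℝ) / Real.sqrt n * ((1 - Real.log n / (2 * a)) * (-1)) := by ring
  rw [this]
  exact mul_le_mul_of_nonneg_left (mul_le_mul_of_nonneg_left hre hw) hΛ

/-- **ONE RUNG BOUNDS THE SPECTRAL MASS AT EVERY HEIGHT.**  Let `q ≠ 1`, `a > 0`, `μ` represent `Q_χ` on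
the tests of `[-a, a]`, `(1+t²)⁻¹ ∈ L¹(μ)`.  Then for every `τ ∈ ℝ`

  `2a·μ{τ} ≤ log q − K_κ + [Re ψ(¼ + iτ/2) − Re ψ(¼)] + 5/a + 2Σ_{log n<2a} Λ(n)n^{-1/2}(1 − log n/(2a))`

— conductor, the archimedean weight of the explicit formula at height `τ` (`~ log|τ|`), and the prime budget
of the window (`~ 4e^a/a`), divided by the window: the positivity form of the classical multiplicity bound. -/
theorem two_mul_mul_atom_le_budget (hq : q ≠ 1) (χ : DirichletCharacter ℂ q) (ha : 0 < a) {μ : Measure ℝ}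
    (hμ : ∀ g : ℝ → ℂ, IsWeilTest g → tsupport g ⊆ Icc (-a) a →
      Integrable (fun t : ℝ ↦ ‖weilMellin g (1 / 2 + t * I)‖ ^ 2) μ ∧
        weilQuadraticChar χ g = ((∫ t, ‖weilMellin g (1 / 2 + t * I)‖ ^ 2 ∂μ : ℝ) : ℂ))
    (hI : Integrable (fun t : ℝ ↦ (1 + t ^ 2)⁻¹) μ) (τ : ℝ) :
    2 * a * μ.real {τ} ≤
      Real.log q - (Real.log (4 * π) + Real.eulerMascheroniConstant +
          2 * ∫ t in Ioi (0 : ℝ), weilKillingDensityPar (charParity χ) t) +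
        (reDigammaQuarter τ - reDigammaQuarter 0) + 5 / a +
        2 * (∑ n ∈ weilPrimeIndex a, (Λ n : ℝ) / Real.sqrt n * (1 - Real.log n / (2 * a))) := by
  have h := two_mul_mul_atom_le hq χ ha hμ hI τ
  have hc := integral_modulationCost_le (charParity χ) ha τ
  have hs := neg_flatSum_le_modulated_flatSum χ ha τ
  linarith

/-! ## Under `GRH(χ)`: the multiplicity of every zero from one window -/

variable [NeZero q] {χ : DirichletCharacter ℂ q}

/-- Under `GRH(χ)` a non-trivial zero with `Im ρ = τ` is `½ + iτ`. -/
theorem eq_of_grh_of_im_eq (hGRH : χ.RiemannHypothesis) {ρ : ℂ} (hρ : ρ ∈ charNontrivialZeros χ) {τ : ℝ}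
    (him : ρ.im = τ) : ρ = 1 / 2 + τ * I := by
  obtain ⟨hL, h0, h1⟩ := hρ
  have hre : ρ.re = 1 / 2 := hGRH ρ hL h0 h1
  apply Complex.ext <;> simp [hre, him]

/-- **The atoms of `ν_χ` are the multiplicities** (under `GRH(χ)`, `χ ≠ 1`): `ν_χ{τ} = ord_{s=½+iτ} L(s, χ)`. -/
theorem charZeroHeightMeasure_singleton_of_grh (hχ : χ ≠ 1) (hGRH : χ.RiemannHypothesis) (τ : ℝ) :
    charZeroHeightMeasure χ {τ} = (DirichletDisc.zeroOrder χ (1 / 2 + τ * I) : ENNReal) := by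
  classical
  rw [charZeroHeightMeasure, Measure.sum_apply _ (measurableSet_singleton τ)]
  simp only [Measure.smul_apply, smul_eq_mul]
  by_cases hmem : (1 / 2 + τ * I : ℂ) ∈ charNontrivialZeros χ
  · rw [tsum_eq_single ⟨1 / 2 + τ * I, hmem⟩]
    · simp [Measure.dirac_apply' _ (measurableSet_singleton τ)]
    · intro ρ hρ
      have him : (ρ : ℂ).im ≠ τ := fun h ↦ hρ (Subtype.ext (eq_of_grh_of_im_eq hGRH ρ.2 h))
      rw [Measure.dirac_apply' _ (measurableSet_singleton τ), indicator_of_notMem (by simpa using him),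
        mul_zero]
  · have hzero : DirichletDisc.zeroOrder χ (1 / 2 + τ * I) = 0 := by
      by_contra h
      have hpos : 0 < DirichletDisc.zeroOrder χ (1 / 2 + τ * I) := Nat.pos_of_ne_zero h
      rw [DirichletDisc.zeroOrder_pos_iff χ hχ] at hpos
      exact hmem ⟨hpos, by simp, by norm_num⟩
    rw [hzero, Nat.cast_zero]
    refine ENNReal.tsum_eq_zero.2 fun ρ ↦ ?_
    have him : (ρ : ℂ).im ≠ τ := fun h ↦ by
      have := eq_of_grh_of_im_eq hGRH ρ.2 h
      exact hmem (this ▸ ρ.2)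
    rw [Measure.dirac_apply' _ (measurableSet_singleton τ), indicator_of_notMem (by simpa using him),
      mul_zero]

/-- **`GRH(χ)` ⟹ THE MULTIPLICITY OF EVERY ZERO FROM ONE WINDOW.**  For `χ` primitive mod `q ≠ 1` with
`GRH(χ)`, every window `a > 0` and every height `τ`:

  `2a · ord_{s=½+iτ} L(s, χ) ≤ log q − K_κ + [Re ψ(¼ + iτ/2) − Re ψ(¼)] + 5/a + 2Σ_{log n<2a} Λ(n)n^{-1/2}(1 − log n/(2a))`.

With `2Σ_{n<e^{2a}}Λ(n)n^{-1/2} ≍ 4e^a/a` and `a ≍ log log(q(|τ|+3))` this is the classical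
`ord ≪ log(q(|τ|+3))/log log(q(|τ|+3))`, here from Weil POSITIVITY at one window. -/
theorem two_mul_mul_zeroOrder_le_of_grh (hq : q ≠ 1) (hprim : χ.IsPrimitive) (hGRH : χ.RiemannHypothesis)
    (ha : 0 < a) (τ : ℝ) :
    2 * a * (DirichletDisc.zeroOrder χ (1 / 2 + τ * I) : ℝ) ≤
      Real.log q - (Real.log (4 * π) + Real.eulerMascheroniConstant +
          2 * ∫ t in Ioi (0 : ℝ), weilKillingDensityPar (charParity χ) t) +
        (reDigammaQuarter τ - reDigammaQuarter 0) + 5 / a +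
        2 * (∑ n ∈ weilPrimeIndex a, (Λ n : ℝ) / Real.sqrt n * (1 - Real.log n / (2 * a))) := by
  have hq1 : 1 < q := lt_of_le_of_ne NeZero.one_le (Ne.symm hq)
  have hχ : χ ≠ 1 := by
    rintro rfl
    rw [DirichletCharacter.isPrimitive_def, DirichletCharacter.conductor_one] at hprim
    exact hq hprim.symm
  have hm : (charZeroHeightMeasure χ).real {τ} = (DirichletDisc.zeroOrder χ (1 / 2 + τ * I) : ℝ) := by
    rw [measureReal_def, charZeroHeightMeasure_singleton_of_grh hχ hGRH τ, ENNReal.toReal_natCast]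
  rw [← hm]
  exact two_mul_mul_atom_le_budget hq χ ha
    (fun g hg _ ↦ WeilBochner.weilQuadraticChar_eq_integral_of_riemannHypothesis hq hprim hGRH hg)
    (integrable_inv_one_add_sq_charZeroHeightMeasure hprim hq1) τ

end Summit.Ventures.WeilGRH

end
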